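import Summits.BirchSwinnertonDyer.BirchSwinnertonDyer.Theorems.EisensteinPrimesHidaSpecialisationRigidity
import Mathlib.RingTheory.LocalRing.Module
import Mathlib.LinearAlgebra.TensorProduct.Quotient
import Mathlib.LinearAlgebra.Dimension.Free
import HarnessLib

/-!
# The β-branch / «Gorenstein-defect» criterion of MEMO-24 §1 (c) as kernel algebra: over a local ring,
# `Φ ∈ 𝔪W ⟺ W ⧸ ΛΦ is not free`; with `ΛΦ` saturated this forces `rank W ≥ 2` (cell `bsd-eis`, seat
# `bsd-line-x2-p2` gen 2, D-0154 KEY row 5; route `EisensteinPrimes`, crux 4 `BSDpOnCellC`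
# stmt-BirchSwinnertonDyer-19034 line b1 v10 / crux 3 `MazurMCOnCellB`; memo `HOME/cgshw-MEMO-24.md`
# §1 (c); companions p606630, p607009, `…HidaSpecialisationRigidity`)

HONEST FRAMING (cell `bsd-eis`, run/shared/lean/pub/bsd-eis/): pure commutative algebra over an
abstract local ring `Λ` (Mathlib only); NO Hecke algebra `𝕋_𝔪`, `Λ`-adic symbol module `𝕎` or Hida
family is constructed or asserted — the memo's identification «`W` = `𝕎` = Greenberg–Stevens' ordinary
`Λ`-adic symbols, `Φ` = the generator `Φ₀` of `𝕎[𝔓_𝕀]`» stays at memo level; nothing is booked; X2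
stays CONSTRUCTION-SHAPED; no label or count moves; BSD and the main conjectures are proved for no
curve. Helper attached to stmt-BirchSwinnertonDyer-19034 (`--supports`), closes no stub.

## The point

MEMO-24 §1 (c) («WHEN CAN `Φ̄ = 0` HAPPEN») reads: «Elementary: `Φ̄₀ = 0 ⟺ Tor₁^Λ(𝕎/ΛΦ₀, 𝔽_p) ≠ 0 ⟺
𝕎/ΛΦ₀` is NOT `Λ`-free; so `n ≥ 2` is necessary» — the mechanism by which a `λ`-jump between the
members of one branch (MEMO-23 §5 (F-D), observed at 1020e1 / 660c1) detects that the free `Λ`-module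
`𝕎` of rank `n` does not split off the saturated line `ΛΦ₀`. Here `Φ̄ = 0` means `Φ ∈ 𝔪_Λ𝕎`. This file
proves these sentences for an arbitrary local ring `(Λ, 𝔪, k)`, a `Λ`-module `W` and `Φ ∈ W`:

* §1 `one_tmul_eq_zero_iff` — `1 ⊗ Φ = 0` in `k ⊗_Λ W` iff `Φ ∈ 𝔪W` (the `Tor`/base-change reading).
* §2 `free_quotient_span_of_not_mem` — `W` finite free, `Φ ∉ 𝔪W` ⇒ `W ⧸ ΛΦ` is free (Mathlib's
  `Module.free_of_lTensor_residueField_injective` on the presentation `Λ —Φ→ W → W ⧸ ΛΦ → 0`: the map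
  `k → k ⊗ W`, `1 ↦ 1 ⊗ Φ`, is injective because `k` has no proper non-zero `Λ`-submodule).
* §3 `eq_zero_of_mem_of_projective_quotient` — conversely `W ⧸ ΛΦ` projective and `Φ ∈ 𝔪W` ⇒ `Φ = 0`
  (split the projection, push `Φ ∈ 𝔪W` into `𝔪·ΛΦ`, so `(1 − m)Φ = 0` with `1 − m` a unit); hence for
  `Φ ≠ 0` in a finite free `W`: **`Φ ∈ 𝔪W ⟺ W ⧸ ΛΦ` is not free** (`mem_smul_top_iff_not_free`).
* §4 `not_mem_smul_top_of_finrank_eq_one`, **`two_le_finrank`** — over a local DOMAIN, if `ΛΦ` is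
  saturated (`W ⧸ ΛΦ` torsion-free), `Φ ≠ 0` and `Φ ∈ 𝔪W`, then `finrank W ≥ 2`: the memo's «`n ≥ 2` is
  necessary», i.e. a β-branch needs a second `Λ`-adic eigen-line through `𝔪` (the `N′`-old
  Eisenstein-congruent families of MEMO-24 §3).
* §5 the weight algebra `Λ_S = ℤ_p⟦S⟧`: `Φ ∈ 𝔪W ⟺ Φ = p·Ψ + S·Ξ` (`mem_smul_top_iff_exists_two_line`, the
  two-line model of p607009 / MEMO-23 §5 at the MODULE level), `two_le_finrank_of_two_line`, and the link
  to the companion's β-criterion on series: a `Λ_S`-linear `L : W → Λ_S⟦T⟧` sends a β-branch `Φ` to a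
  two-variable `G = L Φ` with `Ḡ = 0` (`redFam_apply_eq_zero_of_mem`; then
  `HidaSpecialisationRigidity` §4–§6 apply to every specialisation of `G`).

What this is NOT: not a statement about `𝕋_𝔪`-modules (the Gorenstein / «free or co-free EXCLUDES it»
half of §1 (c) needs the Hecke structure and stays memo-level); nothing about any curve.

References: [EmertonPollackWeston2006] §3 (the Hida-family formalism the memo varies; cited for
context); [GreenbergStevens1993] Thm. (6.1) p. 438 (`𝕎` free over `Λ`, memo level); cell memo cgshw
MEMO-24 §1 (c) e922e989f5e38c02, MEMO-23 §5 (F-D).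
-/

set_option autoImplicit false
set_option linter.dupNamespace false -- the summit namespace `…BirchSwinnertonDyer.BirchSwinnertonDyer.Theorems` (Sub = Summit, D-0017) trips it

noncomputable section

open scoped Classical TensorProduct

open IsLocalRing TensorProduct

namespace Summit.BirchSwinnertonDyer.BirchSwinnertonDyer.Theorems.GorensteinDefectCriterion

variable {Λ : Type*} [CommRing Λ] [IsLocalRing Λ] {W : Type*} [AddCommGroup W] [Module Λ W]

/-! ## §1. `Φ̄ = 0 ⟺ Φ ∈ 𝔪W`, read in `k ⊗_Λ W` -/

/-- **`1 ⊗ Φ = 0` in `k ⊗_Λ W` iff `Φ ∈ 𝔪W`** (`k ⊗_Λ W ≅ W/𝔪W`, Mathlib's `quotTensorEquivQuotSMul`).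
This is the memo's «`Φ̄₀ = 0`», and — since `Tor₁^Λ(W/ΛΦ, k) → k ⊗ ΛΦ → k ⊗ W` is exact with `W` free —
its `Tor` reading. [folklore] -/
theorem one_tmul_eq_zero_iff (Φ : W) :
    (1 : ResidueField Λ) ⊗ₜ[Λ] Φ = 0 ↔ Φ ∈ (maximalIdeal Λ) • (⊤ : Submodule Λ W) := by
  change (Ideal.Quotient.mk (maximalIdeal Λ) 1 : Λ ⧸ maximalIdeal Λ) ⊗ₜ[Λ] Φ =
      (0 : (Λ ⧸ maximalIdeal Λ) ⊗[Λ] W) ↔ _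
  rw [← (quotTensorEquivQuotSMul W (maximalIdeal Λ)).map_eq_zero_iff, quotTensorEquivQuotSMul_mk_tmul,
    one_smul, Submodule.Quotient.mk_eq_zero]

/-- `Λ`-scalars act on `k ⊗ W` through their residues: `r • x = 0` with `r ∉ 𝔪` forces `x = 0`.
[folklore] -/
theorem smul_eq_zero_of_not_mem {r : Λ} (hr : r ∉ maximalIdeal Λ) {V : Type*} [AddCommGroup V]
    [Module Λ V] {x : V} (h : r • x = 0) : x = 0 :=
  ((IsLocalRing.notMem_maximalIdeal.mp hr).smul_eq_zero).mp h

/-! ## §2. `Φ ∉ 𝔪W` ⇒ `W ⧸ ΛΦ` is free -/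

/-- The map `k ⊗ Λ → k ⊗ W` induced by `1 ↦ Φ` is injective as soon as `Φ ∉ 𝔪W`: an element of
`k ⊗_Λ Λ` is `c ⊗ 1` with `c = r̄`; if `r ∈ 𝔪` it is zero, otherwise `r` is a unit and
`c ⊗ Φ = r • (1 ⊗ Φ) = 0` would give `1 ⊗ Φ = 0`, i.e. `Φ ∈ 𝔪W`. [folklore] -/
theorem lTensor_toSpanSingleton_injective {Φ : W}
    (hΦ : Φ ∉ (maximalIdeal Λ) • (⊤ : Submodule Λ W)) :
    Function.Injective ((LinearMap.toSpanSingleton Λ W Φ).lTensor (ResidueField Λ)) := by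
  rw [injective_iff_map_eq_zero]
  intro x hx
  have hx' : x = (TensorProduct.rid Λ (ResidueField Λ) x) ⊗ₜ[Λ] (1 : Λ) := by
    rw [← TensorProduct.rid_symm_apply, LinearEquiv.symm_apply_apply]
  set c : ResidueField Λ := TensorProduct.rid Λ (ResidueField Λ) x with hc
  obtain ⟨r, hr⟩ := residue_surjective c
  rw [hx', LinearMap.lTensor_tmul, LinearMap.toSpanSingleton_apply_one] at hx
  by_cases hrm : r ∈ maximalIdeal Λ
  · have hc0 : c = 0 := by rw [← hr]; exact (residue_eq_zero_iff r).mpr hrm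
    rw [hx', hc0, zero_tmul]
  · exfalso
    apply hΦ
    rw [← one_tmul_eq_zero_iff]
    have hcr : c = r • (1 : ResidueField Λ) := by
      rw [Algebra.smul_def, mul_one, ResidueField.algebraMap_eq, hr]
    rw [hcr, ← smul_tmul'] at hx
    exact smul_eq_zero_of_not_mem hrm hx

/-- **`Φ ∉ 𝔪W` ⇒ `W ⧸ ΛΦ` is free** (`W` finite free over the local ring `Λ`): `Φ` extends to a basis.
Mathlib's `Module.free_of_lTensor_residueField_injective` on `Λ —(·Φ)→ W → W ⧸ ΛΦ → 0`.
(MEMO-24 §1 (c): «`𝕎/ΛΦ₀` not free» can only happen when `Φ̄₀ = 0`.) [folklore] -/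
theorem free_quotient_span_of_not_mem [Module.Finite Λ W] [Module.Free Λ W] {Φ : W}
    (hΦ : Φ ∉ (maximalIdeal Λ) • (⊤ : Submodule Λ W)) :
    Module.Free Λ (W ⧸ Submodule.span Λ {Φ}) := by
  have hrange : LinearMap.range (LinearMap.toSpanSingleton Λ W Φ) = Submodule.span Λ {Φ} :=
    (LinearMap.span_singleton_eq_range Λ W Φ).symm
  have hfree : Module.Free Λ (W ⧸ LinearMap.range (LinearMap.toSpanSingleton Λ W Φ)) :=
    Module.free_of_lTensor_residueField_injective (LinearMap.toSpanSingleton Λ W Φ)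
      (LinearMap.range (LinearMap.toSpanSingleton Λ W Φ)).mkQ (Submodule.mkQ_surjective _)
      (LinearMap.exact_map_mkQ_range _) (lTensor_toSpanSingleton_injective hΦ)
  exact Module.Free.of_equiv (Submodule.quotEquivOfEq _ _ hrange)

/-! ## §3. `W ⧸ ΛΦ` projective and `Φ ∈ 𝔪W` ⇒ `Φ = 0`; the criterion -/

/-- **`W ⧸ ΛΦ` projective ⇒ (`Φ ∈ 𝔪W ⇒ Φ = 0`)** over a local ring, for ANY `Λ`-module `W`: split
`W → W ⧸ ΛΦ` by `s`, let `π = 1 − s∘pr` (a `Λ`-linear retraction of `W` into `ΛΦ` fixing `Φ`); then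
`Φ = π Φ ∈ π(𝔪W) ⊆ 𝔪·ΛΦ`, so `Φ = mΦ` with `m ∈ 𝔪` and `(1 − m)Φ = 0` with `1 − m` a unit. [folklore] -/
theorem eq_zero_of_mem_of_projective_quotient {Φ : W}
    [Module.Projective Λ (W ⧸ Submodule.span Λ {Φ})]
    (hΦ : Φ ∈ (maximalIdeal Λ) • (⊤ : Submodule Λ W)) : Φ = 0 := by
  set N : Submodule Λ W := Submodule.span Λ {Φ} with hN
  obtain ⟨s, hs⟩ := Module.projective_lifting_property N.mkQ (LinearMap.id : (W ⧸ N) →ₗ[Λ] W ⧸ N)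
    (Submodule.mkQ_surjective N)
  let π : W →ₗ[Λ] W := LinearMap.id - s.comp N.mkQ
  have hπN : ∀ w, π w ∈ N := fun w ↦ by
    rw [← Submodule.ker_mkQ N, LinearMap.mem_ker]
    have : N.mkQ (s (N.mkQ w)) = N.mkQ w := by
      rw [← LinearMap.comp_apply, hs, LinearMap.id_apply]
    simp only [π, LinearMap.sub_apply, LinearMap.id_apply, LinearMap.comp_apply, map_sub, this,
      sub_self]
  have hΦN : N.mkQ Φ = 0 := by
    rw [Submodule.mkQ_apply, Submodule.Quotient.mk_eq_zero]
    exact Submodule.mem_span_singleton_self Φ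
  have hπΦ : π Φ = Φ := by
    simp only [π, LinearMap.sub_apply, LinearMap.id_apply, LinearMap.comp_apply, hΦN, map_zero,
      sub_zero]
  have h1 : π Φ ∈ (maximalIdeal Λ) • Submodule.map π ⊤ := by
    rw [← Submodule.map_smul'']
    exact Submodule.mem_map_of_mem hΦ
  have h2 : Submodule.map π ⊤ ≤ N := by
    rintro _ ⟨w, -, rfl⟩
    exact hπN w
  have h3 : Φ ∈ (maximalIdeal Λ) • N := hπΦ ▸ Submodule.smul_mono le_rfl h2 h1
  obtain ⟨m, hm, hmΦ⟩ := Submodule.mem_smul_span_singleton.mp h3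
  have hu : IsUnit (1 - m) :=
    isUnit_one_sub_self_of_mem_nonunits m ((mem_maximalIdeal m).mp hm)
  have h0 : (1 - m) • Φ = 0 := by rw [sub_smul, one_smul, hmΦ, sub_self]
  exact hu.smul_eq_zero.mp h0

/-- **The criterion (MEMO-24 §1 (c), «`Φ̄₀ = 0 ⟺ 𝕎/ΛΦ₀` is NOT `Λ`-free»).** For `W` finite free over a
local ring and `Φ ≠ 0`: `Φ ∈ 𝔪W ⟺ W ⧸ ΛΦ` is not free. [folklore] -/
theorem mem_smul_top_iff_not_free [Module.Finite Λ W] [Module.Free Λ W] {Φ : W} (hΦ0 : Φ ≠ 0) :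
    Φ ∈ (maximalIdeal Λ) • (⊤ : Submodule Λ W) ↔ ¬ Module.Free Λ (W ⧸ Submodule.span Λ {Φ}) := by
  constructor
  · intro hmem hfree
    haveI := hfree
    exact hΦ0 (eq_zero_of_mem_of_projective_quotient hmem)
  · intro hnot
    by_contra hmem
    exact hnot (free_quotient_span_of_not_mem hmem)

/-- With `1 ⊗ Φ` (§1): for `W` finite free and `Φ ≠ 0`, `1 ⊗ Φ = 0` in `k ⊗ W` iff `W ⧸ ΛΦ` is not free.
[folklore] -/
theorem one_tmul_eq_zero_iff_not_free [Module.Finite Λ W] [Module.Free Λ W] {Φ : W} (hΦ0 : Φ ≠ 0) :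
    (1 : ResidueField Λ) ⊗ₜ[Λ] Φ = 0 ↔ ¬ Module.Free Λ (W ⧸ Submodule.span Λ {Φ}) := by
  rw [one_tmul_eq_zero_iff, mem_smul_top_iff_not_free hΦ0]

/-! ## §4. Saturation: `ΛΦ` saturated, `Φ ≠ 0`, `Φ ∈ 𝔪W` ⇒ `finrank W ≥ 2` -/

/-- A free module of finrank `1` is cyclic: some `g` with `W = Λg`. [folklore] -/
theorem exists_generator_of_finrank_eq_one [Module.Finite Λ W] [Module.Free Λ W]
    (h1 : Module.finrank Λ W = 1) : ∃ g : W, ∀ w : W, ∃ c : Λ, w = c • g := by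
  let b := Module.Free.chooseBasis Λ W
  have hcard : Fintype.card (Module.Free.ChooseBasisIndex Λ W) = 1 := by
    rw [← Module.finrank_eq_card_chooseBasisIndex, h1]
  obtain ⟨hU⟩ := Fintype.card_eq_one_iff_nonempty_unique.mp hcard
  letI := hU
  refine ⟨b default, fun w ↦ ⟨b.repr w default, ?_⟩⟩
  conv_lhs => rw [← b.sum_repr w]
  rw [Fintype.sum_unique]

/-- **Rank one excludes the β-configuration.** Over a local DOMAIN `Λ`, let `W` be free of finrank `1`,
`Φ ≠ 0`, and `ΛΦ` saturated (`W ⧸ ΛΦ` torsion-free). Then `W ⧸ ΛΦ = 0` — so it is free and `Φ ∉ 𝔪W`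
(§3). (`W = Λg`, `Φ = a·g` with `a ≠ 0`; `a` kills `W ⧸ ΛΦ`.) [folklore] -/
theorem subsingleton_quotient_of_finrank_eq_one [IsDomain Λ] [Module.Finite Λ W] [Module.Free Λ W]
    (h1 : Module.finrank Λ W = 1) {Φ : W} (hΦ0 : Φ ≠ 0)
    [NoZeroSMulDivisors Λ (W ⧸ Submodule.span Λ {Φ})] :
    Subsingleton (W ⧸ Submodule.span Λ {Φ}) := by
  obtain ⟨g, hg⟩ := exists_generator_of_finrank_eq_one h1
  obtain ⟨a, ha⟩ := hg Φ
  have ha0 : a ≠ 0 := by rintro rfl; exact hΦ0 (by rw [ha, zero_smul])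
  refine ⟨fun x y ↦ ?_⟩
  suffices h : ∀ z : W ⧸ Submodule.span Λ {Φ}, z = 0 by rw [h x, h y]
  intro z
  obtain ⟨w, rfl⟩ := Submodule.mkQ_surjective (Submodule.span Λ {Φ}) z
  obtain ⟨c, hc⟩ := hg w
  have hz : a • Submodule.mkQ (Submodule.span Λ {Φ}) w = 0 := by
    rw [← map_smul, hc, smul_smul, mul_comm, ← smul_smul, ← ha, Submodule.mkQ_apply,
      Submodule.Quotient.mk_eq_zero]
    exact Submodule.smul_mem _ c (Submodule.mem_span_singleton_self Φ)
  exact (smul_eq_zero.mp hz).resolve_left ha0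

/-- Hence in finrank `1` a non-zero `Φ` with `ΛΦ` saturated is NOT in `𝔪W` (it generates `W`).
[folklore] -/
theorem not_mem_smul_top_of_finrank_eq_one [IsDomain Λ] [Module.Finite Λ W] [Module.Free Λ W]
    (h1 : Module.finrank Λ W = 1) {Φ : W} (hΦ0 : Φ ≠ 0)
    [NoZeroSMulDivisors Λ (W ⧸ Submodule.span Λ {Φ})] :
    Φ ∉ (maximalIdeal Λ) • (⊤ : Submodule Λ W) := by
  haveI := subsingleton_quotient_of_finrank_eq_one h1 hΦ0
  intro hmem
  exact hΦ0 (eq_zero_of_mem_of_projective_quotient hmem)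

/-- A finite free module of finrank `0` is trivial. [folklore] -/
theorem eq_zero_of_finrank_eq_zero [Module.Finite Λ W] [Module.Free Λ W]
    (h0 : Module.finrank Λ W = 0) (w : W) : w = 0 := by
  let b := Module.Free.chooseBasis Λ W
  have hcard : Fintype.card (Module.Free.ChooseBasisIndex Λ W) = 0 := by
    rw [← Module.finrank_eq_card_chooseBasisIndex, h0]
  haveI : IsEmpty (Module.Free.ChooseBasisIndex Λ W) := Fintype.card_eq_zero_iff.mp hcard
  rw [← b.sum_repr w, Fintype.sum_empty]

/-- **MEMO-24 §1 (c): «so `n ≥ 2` is necessary».** Over a local DOMAIN `Λ`, if `W` is finite free,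
`Φ ≠ 0`, `ΛΦ` is saturated in `W` (`W ⧸ ΛΦ` torsion-free — e.g. `Φ₀` a generator of `𝕎[𝔓_𝕀]`) and
`Φ ∈ 𝔪W` (a β-branch: `Φ̄₀ = 0`), then `finrank_Λ W ≥ 2`: a second independent line through `𝔪` is
forced. [folklore] -/
theorem two_le_finrank [IsDomain Λ] [Module.Finite Λ W] [Module.Free Λ W] {Φ : W} (hΦ0 : Φ ≠ 0)
    [NoZeroSMulDivisors Λ (W ⧸ Submodule.span Λ {Φ})]
    (hmem : Φ ∈ (maximalIdeal Λ) • (⊤ : Submodule Λ W)) : 2 ≤ Module.finrank Λ W := by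
  by_contra hlt
  rw [not_le] at hlt
  interval_cases h : Module.finrank Λ W
  · exact hΦ0 (eq_zero_of_finrank_eq_zero h Φ)
  · exact not_mem_smul_top_of_finrank_eq_one h hΦ0 hmem

/-! ## §5. The weight algebra `Λ_S = ℤ_p⟦S⟧`: the two-line model at the module level -/

section WeightAlgebra

variable {p : ℕ} [Fact p.Prime] {V : Type*} [AddCommGroup V] [Module (PowerSeries ℤ_[p]) V]

/-- **`Φ ∈ 𝔪W ⟺ Φ = p·Ψ + S·Ξ`** for a module `W` over the weight algebra `Λ_S = ℤ_p⟦S⟧` (`𝔪 = (p, S)`,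
companion `HidaSpecialisationRigidity.mem_maximalIdeal_iff_exists`): the two-line shape
`Φ₀ = p·Ψ + s·Ξ` that p607009 `WeightResiduePencil.specialisation_bracket` takes as a hypothesis is
EXACTLY membership in `𝔪_Λ𝕎` («`Φ̄₀ = 0`»). [folklore] -/
theorem mem_smul_top_iff_exists_two_line (Φ : V) :
    Φ ∈ (maximalIdeal (PowerSeries ℤ_[p])) • (⊤ : Submodule (PowerSeries ℤ_[p]) V) ↔
      ∃ Ψ Ξ : V, Φ = (PowerSeries.C (p : ℤ_[p]) : PowerSeries ℤ_[p]) • Ψ +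
        (PowerSeries.X : PowerSeries ℤ_[p]) • Ξ := by
  constructor
  · intro h
    refine Submodule.smul_induction_on h ?_ ?_
    · intro r hr n _
      obtain ⟨a, b, rfl⟩ := (HidaSpecialisationRigidity.mem_maximalIdeal_iff_exists r).mp hr
      exact ⟨a • n, b • n, by rw [add_smul, mul_smul, mul_smul]⟩
    · rintro x y ⟨Ψ₁, Ξ₁, rfl⟩ ⟨Ψ₂, Ξ₂, rfl⟩
      exact ⟨Ψ₁ + Ψ₂, Ξ₁ + Ξ₂, by rw [smul_add, smul_add]; abel⟩
  · rintro ⟨Ψ, Ξ, rfl⟩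
    refine Submodule.add_mem _ (Submodule.smul_mem_smul ?_ Submodule.mem_top)
      (Submodule.smul_mem_smul ?_ Submodule.mem_top)
    · exact (HidaSpecialisationRigidity.mem_maximalIdeal_iff_exists _).mpr ⟨1, 0, by ring⟩
    · exact (HidaSpecialisationRigidity.mem_maximalIdeal_iff_exists _).mpr ⟨0, 1, by ring⟩

/-- **MEMO-24 §1 (c) for the weight algebra: a β-branch forces `rank_{Λ_S} 𝕎 ≥ 2`.** If `W` is finite
free over `ℤ_p⟦S⟧`, `Φ = p·Ψ + S·Ξ ≠ 0` and `Λ_SΦ` is saturated in `W`, then `finrank W ≥ 2`.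
(`ℤ_p⟦S⟧` is a local domain; §4.) [folklore] -/
theorem two_le_finrank_of_two_line [Module.Finite (PowerSeries ℤ_[p]) V]
    [Module.Free (PowerSeries ℤ_[p]) V] {Φ Ψ Ξ : V}
    (hΦ : Φ = (PowerSeries.C (p : ℤ_[p]) : PowerSeries ℤ_[p]) • Ψ + (PowerSeries.X : PowerSeries ℤ_[p]) • Ξ)
    (hΦ0 : Φ ≠ 0) [NoZeroSMulDivisors (PowerSeries ℤ_[p]) (V ⧸ Submodule.span (PowerSeries ℤ_[p]) {Φ})] :
    2 ≤ Module.finrank (PowerSeries ℤ_[p]) V :=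
  two_le_finrank hΦ0 ((mem_smul_top_iff_exists_two_line Φ).mpr ⟨Ψ, Ξ, hΦ⟩)

/-- **β-branch in `W` ⇒ β-criterion for its two-variable image.** For a `Λ_S`-linear
`L : W → Λ_S⟦T⟧` (memo level: the two-variable `L`-function on `𝕎`, CLAIM 2) and `Φ ∈ 𝔪W`, the series
`G = L Φ` satisfies `Ḡ = 0` (companion `redFam_eq_zero_iff_exists_two_line`), so every specialisation
of `G` is divisible by `p` (`C_dvd_map_of_redFam_eq_zero`) and the bracket/pencil analysis of
`HidaSpecialisationRigidity` §6 applies. [folklore] -/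
theorem redFam_apply_eq_zero_of_mem (L : V →ₗ[PowerSeries ℤ_[p]] PowerSeries (PowerSeries ℤ_[p]))
    {Φ : V} (h : Φ ∈ (maximalIdeal (PowerSeries ℤ_[p])) • (⊤ : Submodule (PowerSeries ℤ_[p]) V)) :
    PowerSeries.map ((residue ℤ_[p]).comp PowerSeries.constantCoeff) (L Φ) = 0 := by
  obtain ⟨Ψ, Ξ, rfl⟩ := (mem_smul_top_iff_exists_two_line Φ).mp h
  rw [map_add, LinearMap.map_smul, LinearMap.map_smul, PowerSeries.smul_eq_C_mul,
    PowerSeries.smul_eq_C_mul]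
  exact (HidaSpecialisationRigidity.redFam_eq_zero_iff_exists_two_line _).mpr ⟨L Ψ, L Ξ, rfl⟩

end WeightAlgebra

end Summit.BirchSwinnertonDyer.BirchSwinnertonDyer.Theorems.GorensteinDefectCriterion

end
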